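import Literature.Barriers.HubbardSuperconductivity.SourcedOrderWithoutGroundStateLROKomaTasakiClass
import Mathlib.Analysis.InnerProductSpace.PiL2
import Mathlib.Analysis.Normed.Module.FiniteDimension
import Mathlib.Analysis.Complex.Basic
import HarnessLib

/-!
# Barrier: a response floor at a FIXED symmetry-breaking field does not give long-range order, nor a
# non-zero order parameter as the field is removed — even for translation-invariant, volume-independent,
# finite-range interactions (the gapped paramagnet)

Barrier catalogue `Literature/Barriers/HubbardSuperconductivity/` (D-0021), entry
`FiniteFieldResponseWithoutLRO`, companion of `SourcedOrderWithoutGroundStateLRO(.lean, …KomaTasakiClass.lean)`.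

Those two entries concern order seen by an INFINITESIMAL source (`Λ ↑ ℤ^d` first, then `h ↓ 0`: the
Koma–Tasaki / Bogoliubov quasi-average `m*`) and record that `m* > 0 ⇒ ground-state LRO` is the open converse of
Koma–Tasaki 1994 Cor. 2.9 / Lieb–Seiringer–Yngvason 2007 §3; their witnesses carry a volume-DEPENDENT coupling
(`h_x = N⁻¹ S^z_x`) or a fixed finite dimension, and the module docstring of the class-level file states
"nothing here is a counterexample for a fixed translation-invariant finite-range interaction".

The present entry concerns the WEAKER hypothesis that certified numerics can actually deliver (summit
`HubbardSuperconductivity`, cell `hubbard-cq`, obstruction O2 of its START-HERE; LADDER row PC-a "pinning-field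
response"): a FLOOR on the response `m_N(h₀) = N⁻¹⟨O⟩_{h₀} ≥ c` to a symmetry-breaking field of FIXED strength
`h₀ > 0`, uniformly in the volume `N` (from certified energy windows of `H` and `H − h₀ O` via the concavity chord
`m_N(h₀) ≥ (E_N(0) − E_N(h₀))/(h₀ N)`).  For this hypothesis the separation from order is realised by the most
regular systems there are: `N` non-interacting spins `½` in a FIXED field `B > 0` along the symmetry axis,
`H_N = B Σ_x S^z_x`, order operator `O = O^{(1)} = Σ_x S^x_x` (`O^{(2)} = Σ_x S^y_x`), charge `C = Σ_x S^z_x` — an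
on-site (range-0), translation-invariant interaction that does NOT depend on `N`, inside Koma–Tasaki's class
`U1System` with constants `h = B/2`, `o = 1/2`, `r = 2` (`paramagnet N B`).  For every `N ≥ 1`
(`paramagnet_profile`):

* (a) the symmetric ground state is UNIQUE (`|⇓⟩`), with spectral GAP `B` and `⟨(O^{(1)})²⟩ = N/4 = o² N` — no
  long-range order (`≍ N`, not `≍ N²`);
* (b) RESPONSE FLOOR at fixed field: for every `h > 0`, EVERY ground state `Φ` of `H_N − h O` has
  `Re⟨Φ, O Φ⟩ ≥ (N/2)(1 − B/h)`, and its energy lies `≥ (h − B)N/2` below the symmetric ground energy (so the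
  energy CHORD `(E_N(0) − E_N(h))/(hN) ≥ ½(1 − B/h)` as well); ground states of `H_N − hO` exist (compactness);
* (c) RESPONSE CEILING: for every `h > 0`, every ground state `Φ` of `H_N − h O` has `Re⟨Φ, O Φ⟩ ≤ 2hN/B` —
  the field-then-volume order parameter `m* = lim_{h↓0} lim_N m_N(h)` VANISHES, uniformly (`m_N(h) ≤ 2h/B` for
  all `N`).

Given a field `h₀ > 0` and any target `0 < c < 1/2 = o`, the choice `B = h₀(1 − 2c)` gives `m_N(h₀) ≥ c` for
ALL `N` (no volume threshold) with `m* = 0` and no LRO (`FiniteFieldResponseWithoutLRO_holds`).  Consequently an implication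
"`m_N(h₀) ≥ c` for all `N ≥ N₀` ⇒ LRO density `≥ g(c, h₀)`" or "⇒ `m* ≥ g(c, h₀)`" that is valid over
translation-invariant finite-range `U(1)`-symmetric systems with volume-independent bounded interactions must
have `g(c, h₀) ≤ 0` for every `c < o`: the response at one fixed field carries no floor information at all, and
the only inputs that exclude the paramagnet are floor-type themselves (a modulus of continuity of `m(h)` at
`0⁺`, or the ABSENCE of a symmetric-phase gap `B ≤ h₀(1 − 2c/o)` together with something replacing it).  Exact
values, for the record [folklore; not formalised, the bounds (b)–(c) suffice]: `E_N(h) = −(N/2)√(B² + h²)`,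
`m_N(h) = h/(2√(B² + h²))`, longitudinal susceptibility `χ(0⁺) = 1/(2B)`.

## Lean rendering

Everything is built on the spin-`½` calculus of `SourcedOrderWithoutGroundStateLROKomaTasakiClass.lean`
(namespace `VanishingFieldSpins`: `Spins N = ℓ²({↑,↓}^N)`, `diagOp`, `flipOp`, `sz`, `sx`, `sy`, `basisVec`,
`ones`, …); the order operators and the charge of `paramagnet N B` are literally those of `spinSystem N` there
(`order_eq_spinSystem`), so `⟨⇓|(O^{(1)})²|⇓⟩ = N/4` and `O^{(1)}|⇒⟩ = (N/2)|⇒⟩` are imported.  New here: the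
volume-independent Hamiltonian `B Σ S^z_x`, its ground state, uniqueness and gap, the variational response floor
(trial state `|⇒⟩`), and the response ceiling, whose one non-trivial input is the operator inequality
`H_N − h O ≥ −N(B/2 + h²/(2B))` (`re_inner_sourced_ge`), proved site by site by pairing each configuration with
its flip at the site and `2B|h|ab ≤ B²a² + h²b²`.  Ground states of the sourced Hamiltonian are rendered
variationally (`‖Φ‖ = 1 ∧ ∀ ψ, ‖ψ‖ = 1 → Re⟨Φ, KΦ⟩ ≤ Re⟨ψ, Kψ⟩`, as in `KomaTasakiSSB.horschVonDerLinden_eigenstate`);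
their existence is compactness of the unit sphere of the finite-dimensional `Spins N`.  No `sorry`, no named fact.

technique_class: symmetry-breaking-field pinning-field finite-field-response quasi-average Koma-Tasaki-converse response-to-LRO-transfer energy-chord Feynman-Hellmann concavity-in-coupling gapped-paramagnet volume-uniformity
blocks: every route step or certificate mechanism of the shape "a certified FLOOR on the response to a `U(1)`-breaking field of FIXED strength `h₀ > 0` (one-point order parameter `N⁻¹⟨O⟩_{h₀} ≥ c`, or energy chord `(E_N(0) − E_N(h₀))/(h₀N) ≥ c`), uniformly in the volume ⇒ a FLOOR on long-range order `N⁻²⟨O²⟩` of the symmetric ground states, or on the quasi-average `m* = lim_{h↓0} lim_N N⁻¹⟨O⟩_h`" whenever the step is to be carried by structure the paramagnet shares — `U(1)` symmetry with Koma–Tasaki locality and UNIFORM norm/range constants, translation invariance, a volume-INDEPENDENT finite-range interaction, uniqueness and a uniform spectral gap of the symmetric ground state, concavity of `E_N(h)` and the two-sided Feynman–Hellmann sandwich; in the summit's cell `hubbard-cq` this is obstruction O2 against the PC-a "pinning-field response" line (certified `e₀(h)` windows of `H − h Σ_x(Δ_{d,x} + Δ_{d,x}†)` at `h ∈ {0.05,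 0.1, 0.2}`).
because: for every `h₀ > 0` and `c < o = 1/2` the translation-invariant on-site system `H_N = B Σ_x S^z_x`, `B = h₀(1 − 2c) > 0`, has response `N⁻¹ Re⟨Φ, O Φ⟩ ≥ c` in every ground state `Φ` of `H_N − h₀ O` for EVERY `N ≥ 1`, while its symmetric ground state is unique, gapped and has `⟨O²⟩ = N/4` (no LRO) and its response obeys `N⁻¹Re⟨Φ, OΦ⟩ ≤ 2h/B` at every field `h > 0` (so `m* = 0`) — theorem `FiniteFieldResponseWithoutLRO_holds` below; `m(h)` nondecreasing with `m* = inf_{h>0} m(h)` means one field bounds `m*` only from ABOVE [cite: KomaTasaki1994, §1 and §2.5] [cite: LiebSeiringerYngvason2007, §3].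
evasions_known: (i) a certified modulus of continuity of `m(h)` at `h = 0⁺` (integrable longitudinal susceptibility, or certified response at a sequence of fields `h_i ↓ 0` with uniform floor) — floor-strength input, not available from finitely many energy windows; (ii) exclusion of a symmetric-phase spectral gap below `h₀(1 − 2c/o)` is NECESSARY but not sufficient (ordered phases are gapless by the tower of states [cite: KomaTasaki1994, Theorem 2.2]; near-critical gapless paramagnets respond as strongly); (iii) prove LRO directly (reflection positivity and infrared bounds [cite: KennedyLiebShastry1988]) and use the field only in the proved direction LRO ⇒ response [cite: KomaTasaki1994, Corollary 2.9]; (iv) report the finite-field response itself as the certified datum, not as an order statement (cell `hubbard-cq` ruling W1, 2026-08-26).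
scope_caveats: the entry refutes TRANSFER PRINCIPLES (response at fixed field ⇒ order) over classes of systems containing the paramagnet; it says nothing about any specific interacting model (for the Hubbard model at given `(U, n, t′)` the implication may well be true — it is then a statement about that model, to be proved with model-specific input), nothing about the proved direction LRO ⇒ response, and nothing about data at several fields beyond the monotone bound `m* ≤ min_i m(h_i)`; multi-field profiles (flat response `≈ c` on `[h₁, h₀]` without order) are realised by period-two mixtures of soft (`B ≪ h₁`) and hard (`B ≫ h₀`) spins and are not formalised here.
status: established (theorems `paramagnet_profile`, `FiniteFieldResponseWithoutLRO_holds` below; [folklore] physics of the paramagnet; the printed context is the one-sidedness of the quasi-average theory [cite: KomaTasaki1994, §2.5] [cite: LiebSeiringerYngvason2007, §3]).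

## References

* T. Koma, H. Tasaki, J. Stat. Phys. 76 (1994) 745–803, arXiv:cond-mat/9708132 (`KomaTasaki1994`): §1 (order
  parameter under a symmetry-breaking field, volume limit first), §2.3 (the `U(1)` class instantiated here),
  Theorem 2.2 (tower), Corollary 2.9 (LRO ⇒ response), §2.5 (one-sidedness).
* E. H. Lieb, R. Seiringer, J. Yngvason, Rep. Math. Phys. 59 (2007) 389–399, arXiv:math-ph/0610034
  (`LiebSeiringerYngvason2007`): §3 (quasi-average vs. condensation; "a rigorous proof is lacking, so far").
* T. Kennedy, E. H. Lieb, B. S. Shastry, J. Stat. Phys. 53 (1988) 1019 (`KennedyLiebShastry1988`): LRO proved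
  directly (evasion (iii)).
-/

noncomputable section

open Complex Finset
open scoped InnerProductSpace ComplexConjugate

namespace Literature.Barriers.HubbardSuperconductivity

namespace GappedParamagnet

open VanishingFieldSpins
open Literature.MathematicalPhysics.QuantumLattice.KomaTasaki

variable {N : ℕ}

/-! ### The gapped paramagnet as a Koma–Tasaki `U(1)` system -/

/-- **The gapped paramagnet** on `Λ = Fin N`: local Hamiltonians `h_x = B S^z_x` (a uniform field of FIXED
strength `B` along the symmetry axis — independent of `N`), order densities `o^{(1)}_x = S^x_x`,
`o^{(2)}_x = S^y_x`, charge `C = Σ_x S^z_x`, supports `S_x = {x}`, constants `r = 2`, `h = |B|/2`, `o = 1/2`.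
All of Koma–Tasaki's hypotheses (2.12)–(2.14), i)–iii) hold. [cite: KomaTasaki1994, §2.3 (2.12)–(2.17) i)–iii)] -/
def paramagnet (N : ℕ) (B : ℝ) : U1System (Fin N) (Spins N) where
  h x := diagOp x (fun b => (B : ℂ) * szSym b)
  o := ![sx, sy]
  C := ∑ x, sz x
  supp x := {x}
  r := 2
  hbar := |B| / 2
  obar := 1 / 2
  isSymmetric_h x := isSymmetric_diagOp x fun b => by
    rw [map_mul, conj_szSym, Complex.conj_ofReal]
  isSymmetric_o α x := by
    fin_cases α
    · exact isSymmetric_flipOp x conj_sxCoef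
    · exact isSymmetric_flipOp x conj_syCoef
  isSymmetric_C := by
    intro φ ψ
    simp only [ContinuousLinearMap.toLinearMap_sum, LinearMap.coe_sum, ContinuousLinearMap.coe_coe,
      Finset.sum_apply, sum_inner, inner_sum]
    exact Finset.sum_congr rfl fun x _ => isSymmetric_diagOp x conj_szSym φ ψ
  commute_hamiltonian_C :=
    Commute.sum_left _ _ _ fun x _ => Commute.sum_right _ _ _ fun y _ =>
      diagOp_mul_diagOp_comm x y _ _
  order_zero_C := (spinSystem N).order_zero_C
  order_one_C := (spinSystem N).order_one_C
  commute_o x y hxy α β := (spinSystem N).commute_o x y hxy α β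
  commute_h_o x y hy α := by
    have hxy : x ≠ y := fun h => hy (by simp [h])
    fin_cases α <;> exact (flipOp_mul_diagOp_comm (Ne.symm hxy) _ _).symm
  card_supp_le x := by simp
  two_le_r := le_rfl
  norm_h_le x := by
    refine norm_diagOp_le x (by positivity) fun b => ?_
    rw [norm_mul, Complex.norm_real, norm_szSym, Real.norm_eq_abs]
    linarith
  norm_o_le α x := (spinSystem N).norm_o_le α x
  obar_pos := by norm_num

/-- The constants of the paramagnet: `h = |B|/2`, `o = 1/2`, `r = 2`, independent of `N`. [folklore] -/
private theorem paramagnet_constants (N : ℕ) (B : ℝ) :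
    (paramagnet N B).hbar = |B| / 2 ∧ (paramagnet N B).obar = 1 / 2 ∧ (paramagnet N B).r = 2 :=
  ⟨rfl, rfl, rfl⟩

/-- The order operators of the paramagnet are those of the vanishing-field system `spinSystem N`
(same densities `S^x_x`, `S^y_x`). [folklore] -/
private theorem order_eq_spinSystem (B : ℝ) (α : Fin 2) : (paramagnet N B).order α = (spinSystem N).order α := rfl

/-- The charge of the paramagnet is that of `spinSystem N` (`Σ_x S^z_x`). [folklore] -/
private theorem C_eq_spinSystem (B : ℝ) : (paramagnet N B).C = (spinSystem N).C := rfl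

/-- `O^{(1)} = Σ_x S^x_x` as a sum of flip operators. [folklore] -/
private theorem order_zero_eq' (B : ℝ) : (paramagnet N B).order 0 = ∑ x, flipOp x sxCoef := rfl

/-- The Hamiltonian is `B Σ_x S^z_x`, a sum of diagonal operators. [folklore] -/
private theorem hamiltonian_eq (B : ℝ) :
    (paramagnet N B).hamiltonian = ∑ x, diagOp x (fun b => (B : ℂ) * szSym b) := rfl

/-! ### The Hamiltonian in coordinates; ground energy, ground state, uniqueness, gap -/

/-- Real symbol of `S^z`: `±1/2`. [folklore] -/
def szR : Bool → ℝ := fun b => if b then 1 / 2 else -(1 / 2)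

/-- The complex symbol of `S^z` is the real one. [folklore] -/
private theorem szSym_eq (b : Bool) : szSym b = ((szR b : ℝ) : ℂ) := by
  cases b <;> simp [szSym, szR]

/-- `|szR b| = 1/2`. [folklore] -/
private theorem abs_szR (b : Bool) : |szR b| = 1 / 2 := by
  cases b <;> simp [szR, abs_of_pos]

/-- `szR (!b) = − szR b`. [folklore] -/
private theorem szR_not (b : Bool) : szR (!b) = -szR b := by
  cases b <;> simp [szR]

/-- Magnetisation symbol, real form: `Σ_x szR(σ_x) = numUp σ − N/2`. [folklore] -/
private theorem sum_szR (σ : Cfg N) : ∑ x, szR (σ x) = (numUp σ : ℝ) - (N : ℝ) / 2 := by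
  have h := sum_szSym σ
  simp only [szSym_eq, ← Complex.ofReal_sum] at h
  have h2 : ((∑ x, szR (σ x) : ℝ) : ℂ) = (((numUp σ : ℝ) - (N : ℝ) / 2 : ℝ) : ℂ) := by
    rw [h]; push_cast; ring
  exact Complex.ofReal_injective h2

/-- The Hamiltonian acts diagonally: `(H ψ)(σ) = B (numUp σ − N/2) ψ(σ)`. [folklore] -/
private theorem hamiltonian_apply (B : ℝ) (ψ : Spins N) (σ : Cfg N) :
    (paramagnet N B).hamiltonian ψ σ = (B : ℂ) * ((numUp σ : ℂ) - (N : ℂ) / 2) * ψ σ := by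
  rw [hamiltonian_eq, sum_clm_apply_apply, ← sum_szSym, Finset.mul_sum, Finset.sum_mul]
  exact Finset.sum_congr rfl fun x _ => by rw [diagOp_apply, mul_assoc]

/-- Energy expectation in coordinates (real part):
`Re⟨ψ, Hψ⟩ = Σ_σ B (numUp σ − N/2) |ψ(σ)|²`. [folklore] -/
private theorem re_inner_hamiltonian (B : ℝ) (ψ : Spins N) :
    (⟪ψ, (paramagnet N B).hamiltonian ψ⟫_ℂ).re =
      ∑ σ, B * ((numUp σ : ℝ) - (N : ℝ) / 2) * ‖ψ σ‖ ^ 2 := by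
  rw [inner_eq_sum, Complex.re_sum]
  refine Finset.sum_congr rfl fun σ _ => ?_
  rw [hamiltonian_apply, ← mul_assoc, mul_comm (conj (ψ σ)), mul_assoc, mul_assoc,
    ← Complex.normSq_eq_conj_mul_self, Complex.normSq_eq_norm_sq]
  have : ((B : ℂ) * (((numUp σ : ℂ) - (N : ℂ) / 2) * ((‖ψ σ‖ ^ 2 : ℝ) : ℂ))) =
      ((B * (((numUp σ : ℝ) - (N : ℝ) / 2)) * ‖ψ σ‖ ^ 2 : ℝ) : ℂ) := by
    push_cast; ring
  rw [this, Complex.ofReal_re]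

/-- **Ground-energy bound:** `Re⟨ψ, H ψ⟩ ≥ −(BN/2)‖ψ‖²` for `B ≥ 0` (each configuration has `numUp ≥ 0`).
[folklore] -/
private theorem ground_energy_bound {B : ℝ} (hB : 0 ≤ B) (ψ : Spins N) :
    -(B * N / 2) * ‖ψ‖ ^ 2 ≤ (⟪ψ, (paramagnet N B).hamiltonian ψ⟫_ℂ).re := by
  rw [re_inner_hamiltonian, norm_sq_eq_sum, Finset.mul_sum]
  refine Finset.sum_le_sum fun σ _ => ?_
  have h1 : -(B * N / 2) ≤ B * ((numUp σ : ℝ) - (N : ℝ) / 2) := by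
    have : (0 : ℝ) ≤ B * (numUp σ : ℝ) := by positivity
    linarith
  exact mul_le_mul_of_nonneg_right h1 (by positivity)

/-- `|⇓⟩` is an eigenvector of `H` with eigenvalue `−BN/2`. [folklore] -/
private theorem hamiltonian_basisVec_down (B : ℝ) :
    (paramagnet N B).hamiltonian (basisVec down) =
      ((-(B * N / 2) : ℝ) : ℂ) • basisVec (down : Cfg N) := by
  ext σ
  rw [hamiltonian_apply]
  show _ = ((-(B * N / 2) : ℝ) : ℂ) * basisVec down σ
  rw [basisVec_apply]
  split_ifs with h
  · subst h
    rw [numUp_down]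
    push_cast
    ring
  · simp

/-- `|⇓⟩` is a unit vector. [folklore] -/
private theorem norm_basisVec_down : ‖(basisVec (down : Cfg N) : Spins N)‖ = 1 := by
  have h2 : ‖(basisVec (down : Cfg N) : Spins N)‖ ^ 2 = 1 := by
    rw [norm_sq_eq_sum, Finset.sum_eq_single down]
    · simp
    · intro σ _ hσ; simp [hσ]
    · simp
  have h3 : 0 ≤ ‖(basisVec (down : Cfg N) : Spins N)‖ := norm_nonneg _
  nlinarith

/-- **Uniqueness of the ground state** (`B > 0`): an eigenvector of `H` with eigenvalue `−BN/2` is a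
multiple of `|⇓⟩`. [folklore] -/
private theorem eq_smul_basisVec_down_of_ground {B : ℝ} (hB : 0 < B) {g : Spins N}
    (hg : (paramagnet N B).hamiltonian g = ((-(B * N / 2) : ℝ) : ℂ) • g) :
    g = g down • basisVec down := by
  ext σ
  show g σ = g down * basisVec down σ
  rw [basisVec_apply]
  by_cases hσ : σ = down
  · subst hσ; simp
  · rw [if_neg hσ, mul_zero]
    have h1 := congrArg (fun v : Spins N => v σ) hg
    simp only at h1
    rw [hamiltonian_apply] at h1
    change _ = ((-(B * N / 2) : ℝ) : ℂ) * g σ at h1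
    have hpos : 1 ≤ numUp σ := by
      by_contra h0
      exact hσ ((numUp_eq_zero_iff σ).1 (by omega))
    have hcoef : (B : ℂ) * ((numUp σ : ℂ) - (N : ℂ) / 2) - ((-(B * N / 2) : ℝ) : ℂ) ≠ 0 := by
      have : (B : ℂ) * ((numUp σ : ℂ) - (N : ℂ) / 2) - ((-(B * N / 2) : ℝ) : ℂ) =
          ((B * numUp σ : ℝ) : ℂ) := by
        push_cast; ring
      rw [this, Ne, Complex.ofReal_eq_zero]
      have : (0 : ℝ) < B * numUp σ := by
        have : (1 : ℝ) ≤ numUp σ := by exact_mod_cast hpos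
        nlinarith
      exact this.ne'
    have h2 : ((B : ℂ) * ((numUp σ : ℂ) - (N : ℂ) / 2) - ((-(B * N / 2) : ℝ) : ℂ)) * g σ = 0 := by
      rw [sub_mul, h1, sub_self]
    exact (mul_eq_zero.1 h2).resolve_left hcoef

/-- **Spectral gap `B`:** a vector orthogonal to `|⇓⟩` (i.e. with `ψ(⇓) = 0`) has energy
`Re⟨ψ, Hψ⟩ ≥ (−BN/2 + B)‖ψ‖²` (`B ≥ 0`; every other configuration has at least one up spin). [folklore] -/
private theorem gap_bound {B : ℝ} (hB : 0 ≤ B) {ψ : Spins N} (hψ : ψ down = 0) :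
    (-(B * N / 2) + B) * ‖ψ‖ ^ 2 ≤ (⟪ψ, (paramagnet N B).hamiltonian ψ⟫_ℂ).re := by
  rw [re_inner_hamiltonian, norm_sq_eq_sum, Finset.mul_sum]
  refine Finset.sum_le_sum fun σ _ => ?_
  by_cases hσ : σ = down
  · subst hσ; simp [hψ]
  · have hpos : 1 ≤ numUp σ := by
      by_contra h0
      exact hσ ((numUp_eq_zero_iff σ).1 (by omega))
    have h1 : -(B * N / 2) + B ≤ B * ((numUp σ : ℝ) - (N : ℝ) / 2) := by
      have : (1 : ℝ) ≤ numUp σ := by exact_mod_cast hpos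
      nlinarith
    exact mul_le_mul_of_nonneg_right h1 (by positivity)

/-- Orthogonality to `|⇓⟩` in coordinates: `⟨⇓, ψ⟩ = ψ(⇓)`. [folklore] -/
private theorem inner_basisVec_down_left (ψ : Spins N) : ⟪(basisVec (down : Cfg N) : Spins N), ψ⟫_ℂ = ψ down := by
  rw [inner_eq_sum, Finset.sum_eq_single down]
  · simp
  · intro σ _ hσ; simp [hσ]
  · simp

/-! ### The symmetry-broken trial state `|⇒⟩` and the sourced Hamiltonian `H − h O^{(1)}` -/

/-- `|⇒⟩` has zero energy also in the fixed field: `⟨⇒|H|⇒⟩ = 0` (pair `σ` with its global flip).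
[folklore] -/
private theorem inner_hamiltonian_ones (B : ℝ) : ⟪(ones : Spins N), (paramagnet N B).hamiltonian ones⟫_ℂ = 0 := by
  rw [inner_eq_sum]
  simp only [hamiltonian_apply, ones_apply, map_one, one_mul, mul_one]
  rw [← Finset.mul_sum]
  suffices h : ∑ σ : Cfg N, ((numUp σ : ℂ) - (N : ℂ) / 2) = 0 by rw [h, mul_zero]
  have hflip : ∑ σ : Cfg N, ((numUp σ : ℂ) - (N : ℂ) / 2) =
      ∑ σ : Cfg N, -((numUp σ : ℂ) - (N : ℂ) / 2) := by
    rw [← Equiv.sum_comp complEquiv]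
    refine Finset.sum_congr rfl fun σ _ => ?_
    rw [numUp_complEquiv, Nat.cast_sub (numUp_le σ)]
    ring
  have h2 : 2 * ∑ σ : Cfg N, ((numUp σ : ℂ) - (N : ℂ) / 2) = 0 := by
    rw [two_mul]
    nth_rewrite 2 [hflip]
    rw [Finset.sum_neg_distrib, add_neg_cancel]
  exact (mul_eq_zero.1 h2).resolve_left two_ne_zero

/-- `|⇒⟩` is an eigenvector of `O^{(1)}` with the maximal eigenvalue `N/2`. [folklore] -/
private theorem order_zero_ones (B : ℝ) : (paramagnet N B).order 0 ones = ((N : ℂ) / 2) • (ones : Spins N) := by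
  rw [order_eq_spinSystem]; exact VanishingFieldSpins.order_zero_ones

/-- `‖⇒‖² > 0`. [folklore] -/
private theorem norm_ones_pos : 0 < ‖(ones : Spins N)‖ := norm_pos_iff.2 ones_ne_zero

/-- The sourced ("pinned") Hamiltonian `K_h = H − h O^{(1)}` of the paramagnet. [cite: KomaTasaki1994, §1] -/
abbrev sourced (N : ℕ) (B h : ℝ) : Spins N →L[ℂ] Spins N :=
  (paramagnet N B).hamiltonian - (h : ℂ) • (paramagnet N B).order 0

/-- Real part of the sourced energy: `Re⟨ψ, K_h ψ⟩ = Re⟨ψ, Hψ⟩ − h Re⟨ψ, O ψ⟩`. [folklore] -/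
private theorem re_inner_sourced (B h : ℝ) (ψ : Spins N) :
    (⟪ψ, sourced N B h ψ⟫_ℂ).re =
      (⟪ψ, (paramagnet N B).hamiltonian ψ⟫_ℂ).re - h * (⟪ψ, (paramagnet N B).order 0 ψ⟫_ℂ).re := by
  simp only [sourced, FunLike.coe_sub, FunLike.coe_smul, Pi.sub_apply,
    Pi.smul_apply, inner_sub_right, inner_smul_right, Complex.sub_re, Complex.re_ofReal_mul]

/-- Two sources compose: `K_{h+s} = K_h − s O^{(1)}`, in expectation. [folklore] -/
private theorem re_inner_sourced_add (B h s : ℝ) (ψ : Spins N) :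
    (⟪ψ, sourced N B (h + s) ψ⟫_ℂ).re =
      (⟪ψ, sourced N B h ψ⟫_ℂ).re - s * (⟪ψ, (paramagnet N B).order 0 ψ⟫_ℂ).re := by
  rw [re_inner_sourced, re_inner_sourced]
  ring

/-- The trial state `|⇒⟩` has sourced energy `−hN/2` per unit norm: `Re⟨⇒, K_h ⇒⟩ = −(hN/2)‖⇒‖²`.
[cite: KomaTasaki1994, §2.4] -/
theorem re_inner_sourced_ones (B h : ℝ) :
    (⟪(ones : Spins N), sourced N B h ones⟫_ℂ).re = -(h * N / 2) * ‖(ones : Spins N)‖ ^ 2 := by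
  rw [re_inner_sourced, inner_hamiltonian_ones, order_zero_ones, inner_smul_right, Complex.zero_re, zero_sub]
  have hre : (⟪(ones : Spins N), ones⟫_ℂ).re = ‖(ones : Spins N)‖ ^ 2 := by
    have := inner_self_eq_norm_sq (𝕜 := ℂ) (ones : Spins N)
    rwa [RCLike.re_to_complex] at this
  have hc : ((N : ℂ) / 2) = (((N : ℝ) / 2 : ℝ) : ℂ) := by push_cast; ring
  rw [hc, Complex.re_ofReal_mul, hre]
  ring

/-- `⟨⇓, O^{(1)} ⇓⟩ = 0` (a `U(1)`-odd one-point function in a charge eigenstate). [folklore] -/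
private theorem inner_order_zero_basisVec_down (B : ℝ) :
    ⟪(basisVec (down : Cfg N) : Spins N), (paramagnet N B).order 0 (basisVec down)⟫_ℂ = 0 := by
  rw [order_eq_spinSystem, inner_eq_sum]
  refine Finset.sum_eq_zero fun σ _ => ?_
  rw [order_zero_basisVec_down_apply, basisVec_apply]
  by_cases hσ : σ = down
  · subst hσ
    rw [numUp_down]
    simp
  · simp [hσ]

/-- The symmetric ground state has sourced energy `−BN/2` (its `O^{(1)}`-expectation vanishes):
`Re⟨⇓, K_h ⇓⟩ = −BN/2`. [folklore] -/
private theorem re_inner_sourced_basisVec_down (B h : ℝ) :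
    (⟪(basisVec (down : Cfg N) : Spins N), sourced N B h (basisVec down)⟫_ℂ).re = -(B * N / 2) := by
  rw [re_inner_sourced, inner_order_zero_basisVec_down, hamiltonian_basisVec_down, inner_smul_right,
    inner_self_eq_norm_sq_to_K, norm_basisVec_down]
  simp

/-! ### The operator inequality `H − h O^{(1)} ≥ −N (B/2 + h²/(2B))` -/

/-- `Re⟨ψ, O^{(1)} ψ⟩` in coordinates: `Σ_x Σ_σ ½ Re( conj(ψ σ) ψ(flip_x σ) )`. [folklore] -/
private theorem re_inner_order_zero (B : ℝ) (ψ : Spins N) :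
    (⟪ψ, (paramagnet N B).order 0 ψ⟫_ℂ).re =
      ∑ x : Fin N, ∑ σ : Cfg N, (1 / 2) * (conj (ψ σ) * ψ (flipAt x σ)).re := by
  rw [order_zero_eq', inner_eq_sum, Complex.re_sum]
  have : ∀ σ : Cfg N, (conj (ψ σ) * (∑ x : Fin N, flipOp x sxCoef) ψ σ).re =
      ∑ x : Fin N, (1 / 2) * (conj (ψ σ) * ψ (flipAt x σ)).re := by
    intro σ
    rw [sum_clm_apply_apply, Finset.mul_sum, Complex.re_sum]
    refine Finset.sum_congr rfl fun x _ => ?_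
    rw [flipOp_apply, sxCoef]
    have : conj (ψ σ) * (1 / 2 * ψ (flipAt x σ)) = ((1 / 2 : ℝ) : ℂ) * (conj (ψ σ) * ψ (flipAt x σ)) := by
      push_cast; ring
    rw [this, Complex.re_ofReal_mul]
  simp only [this]
  rw [Finset.sum_comm]

/-- `Re⟨ψ, H ψ⟩` in site-resolved coordinates: `Σ_x Σ_σ B szR(σ_x) |ψ σ|²`. [folklore] -/
private theorem re_inner_hamiltonian_sites (B : ℝ) (ψ : Spins N) :
    (⟪ψ, (paramagnet N B).hamiltonian ψ⟫_ℂ).re =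
      ∑ x : Fin N, ∑ σ : Cfg N, B * szR (σ x) * ‖ψ σ‖ ^ 2 := by
  rw [re_inner_hamiltonian, Finset.sum_comm]
  refine Finset.sum_congr rfl fun σ _ => ?_
  rw [← sum_szR, Finset.mul_sum, Finset.sum_mul]

/-- The elementary two-level inequality behind the tangent bound: for `B > 0` and reals `a, b, R` with
`|R| ≤ a b`, `(B/2)(a² − b²) − h R ≥ −(B/2 + h²/(2B)) (a² + b²)` (from `2B|h|ab ≤ B²a² + h²b²`). [folklore] -/
private theorem two_level_bound {B : ℝ} (hB : 0 < B) (h : ℝ) {a b R : ℝ} (hR : |R| ≤ a * b) :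
    -(B / 2 + h ^ 2 / (2 * B)) * (a ^ 2 + b ^ 2) ≤ B / 2 * (a ^ 2 - b ^ 2) - h * R := by
  have h1 : h * R ≤ |h| * (a * b) := by
    calc h * R ≤ |h * R| := le_abs_self _
      _ = |h| * |R| := abs_mul _ _
      _ ≤ |h| * (a * b) := mul_le_mul_of_nonneg_left hR (abs_nonneg _)
  -- `2 B |h| a b ≤ B² a² + h² b²`
  have h2 : |h| * (a * b) ≤ B / 2 * a ^ 2 + h ^ 2 / (2 * B) * b ^ 2 := by
    have hsq : 0 ≤ (B * a - |h| * b) ^ 2 := sq_nonneg _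
    have habs : |h| ^ 2 = h ^ 2 := sq_abs h
    have hB2 : B / 2 * a ^ 2 + h ^ 2 / (2 * B) * b ^ 2 - |h| * (a * b) =
        (B * a - |h| * b) ^ 2 / (2 * B) := by
      field_simp
      ring_nf
      rw [habs]
      ring
    have : 0 ≤ (B * a - |h| * b) ^ 2 / (2 * B) := by positivity
    linarith
  have h3 : 0 ≤ (B / 2 + h ^ 2 / (2 * B)) * a ^ 2 := by positivity
  have h4 : 0 ≤ B / 2 * b ^ 2 := by positivity
  nlinarith

/-- The pairing bound at one site: with `f(σ) = B szR(σ_x)|ψ σ|² − (h/2) Re(conj(ψ σ) ψ(flip_x σ))`,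
`f(σ) + f(flip_x σ) ≥ −(B/2 + h²/(2B)) (|ψ σ|² + |ψ(flip_x σ)|²)`. [folklore] -/
private theorem pair_bound {B : ℝ} (hB : 0 < B) (h : ℝ) (ψ : Spins N) (x : Fin N) (σ : Cfg N) :
    -(B / 2 + h ^ 2 / (2 * B)) * (‖ψ σ‖ ^ 2 + ‖ψ (flipAt x σ)‖ ^ 2) ≤
      (B * szR (σ x) * ‖ψ σ‖ ^ 2 - h / 2 * (conj (ψ σ) * ψ (flipAt x σ)).re) +
        (B * szR (flipAt x σ x) * ‖ψ (flipAt x σ)‖ ^ 2 -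
          h / 2 * (conj (ψ (flipAt x σ)) * ψ (flipAt x (flipAt x σ))).re) := by
  rw [flipAt_flipAt, flipAt_apply_same, szR_not]
  -- the two cross terms are equal
  have hcross : (conj (ψ (flipAt x σ)) * ψ σ).re = (conj (ψ σ) * ψ (flipAt x σ)).re := by
    rw [← Complex.conj_re (conj (ψ σ) * ψ (flipAt x σ)), map_mul, Complex.conj_conj, mul_comm]
  rw [hcross]
  set R := (conj (ψ σ) * ψ (flipAt x σ)).re with hRdef
  set a := ‖ψ σ‖
  set b := ‖ψ (flipAt x σ)‖
  have hR : |R| ≤ a * b := by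
    calc |R| ≤ ‖conj (ψ σ) * ψ (flipAt x σ)‖ := Complex.abs_re_le_norm _
      _ = a * b := by rw [norm_mul, Complex.norm_conj]
  cases hx : σ x
  · -- down at `x`: roles of `a` and `b` swapped
    simp only [szR, Bool.false_eq_true, if_false]
    have hR' : |R| ≤ b * a := by rwa [mul_comm]
    have := two_level_bound hB h hR'
    nlinarith [this]
  · simp only [szR, if_true]
    have := two_level_bound hB h hR
    nlinarith [this]

/-- **The tangent (second-order) lower bound on the sourced Hamiltonian:** for `B > 0` and every real `h`,
`Re⟨ψ, (H − h O^{(1)}) ψ⟩ ≥ −N (B/2 + h²/(2B)) ‖ψ‖²` — each site `B S^z_x − h S^x_x ≥ −½√(B² + h²) ≥ −(B/2 + h²/(2B))`.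
[folklore] -/
private theorem re_inner_sourced_ge {B : ℝ} (hB : 0 < B) (h : ℝ) (ψ : Spins N) :
    -(N * (B / 2 + h ^ 2 / (2 * B))) * ‖ψ‖ ^ 2 ≤ (⟪ψ, sourced N B h ψ⟫_ℂ).re := by
  rw [re_inner_sourced, re_inner_hamiltonian_sites, re_inner_order_zero, Finset.mul_sum,
    ← Finset.sum_sub_distrib]
  -- site by site
  have hsite : ∀ x : Fin N,
      -(B / 2 + h ^ 2 / (2 * B)) * ‖ψ‖ ^ 2 ≤
        ∑ σ : Cfg N, B * szR (σ x) * ‖ψ σ‖ ^ 2 -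
          h * ∑ σ : Cfg N, (1 / 2) * (conj (ψ σ) * ψ (flipAt x σ)).re := by
    intro x
    set f : Cfg N → ℝ := fun σ =>
      B * szR (σ x) * ‖ψ σ‖ ^ 2 - h / 2 * (conj (ψ σ) * ψ (flipAt x σ)).re with hf
    have hsum : ∑ σ : Cfg N, B * szR (σ x) * ‖ψ σ‖ ^ 2 -
        h * ∑ σ : Cfg N, (1 / 2) * (conj (ψ σ) * ψ (flipAt x σ)).re = ∑ σ, f σ := by
      rw [Finset.mul_sum, ← Finset.sum_sub_distrib]
      refine Finset.sum_congr rfl fun σ _ => ?_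
      simp only [hf]
      ring
    rw [hsum]
    -- pair each configuration with its flip at `x`
    have hflip : ∑ σ, f (flipAt x σ) = ∑ σ, f σ := Equiv.sum_comp (flipEquiv x) f
    have hnorm : ∑ σ : Cfg N, ‖ψ (flipAt x σ)‖ ^ 2 = ‖ψ‖ ^ 2 := by
      rw [norm_sq_eq_sum]
      exact Equiv.sum_comp (flipEquiv x) (fun σ => ‖ψ σ‖ ^ 2)
    have h2 : 2 * ∑ σ, f σ = ∑ σ, (f σ + f (flipAt x σ)) := by
      rw [Finset.sum_add_distrib, hflip, two_mul]
    have h3 : ∑ σ : Cfg N, -(B / 2 + h ^ 2 / (2 * B)) * (‖ψ σ‖ ^ 2 + ‖ψ (flipAt x σ)‖ ^ 2) ≤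
        ∑ σ, (f σ + f (flipAt x σ)) :=
      Finset.sum_le_sum fun σ _ => pair_bound hB h ψ x σ
    have h4 : ∑ σ : Cfg N, -(B / 2 + h ^ 2 / (2 * B)) * (‖ψ σ‖ ^ 2 + ‖ψ (flipAt x σ)‖ ^ 2) =
        -(B / 2 + h ^ 2 / (2 * B)) * (2 * ‖ψ‖ ^ 2) := by
      rw [← Finset.mul_sum, Finset.sum_add_distrib, hnorm, ← norm_sq_eq_sum]; ring
    linarith
  calc -(N * (B / 2 + h ^ 2 / (2 * B))) * ‖ψ‖ ^ 2
      = ∑ _x : Fin N, -(B / 2 + h ^ 2 / (2 * B)) * ‖ψ‖ ^ 2 := by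
        rw [Finset.sum_const, Finset.card_univ, Fintype.card_fin, nsmul_eq_mul]; ring
    _ ≤ _ := Finset.sum_le_sum fun x _ => hsite x

/-! ### Ground states of the sourced Hamiltonian: existence, energy, response floor and ceiling -/

/-- Variational ground states of an operator `K` on the spin space: unit vectors minimising `Re⟨ψ, Kψ⟩` over
the unit sphere (Koma–Tasaki's "ground state of `H_Λ`" in Theorem 2.2, rendered as in
`KomaTasakiSSB.horschVonDerLinden_eigenstate`). [cite: KomaTasaki1994, §2.3 Theorem 2.2] -/
def IsVariationalGS (K : Spins N →L[ℂ] Spins N) (Φ : Spins N) : Prop :=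
  ‖Φ‖ = 1 ∧ ∀ ψ : Spins N, ‖ψ‖ = 1 → (⟪Φ, K Φ⟫_ℂ).re ≤ (⟪ψ, K ψ⟫_ℂ).re

/-- **Ground states exist** (the unit sphere of the finite-dimensional `Spins N` is compact). [folklore] -/
private theorem exists_isVariationalGS (K : Spins N →L[ℂ] Spins N) : ∃ Φ, IsVariationalGS K Φ := by
  have hc : IsCompact (Metric.sphere (0 : Spins N) 1) := isCompact_sphere 0 1
  have hne : (Metric.sphere (0 : Spins N) 1).Nonempty :=
    ⟨basisVec down, by rw [mem_sphere_zero_iff_norm, norm_basisVec_down]⟩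
  have hcont : Continuous fun ψ : Spins N => (⟪ψ, K ψ⟫_ℂ).re :=
    Complex.continuous_re.comp (Continuous.inner continuous_id K.continuous)
  obtain ⟨Φ, hΦ, hmin⟩ := hc.exists_isMinOn hne hcont.continuousOn
  refine ⟨Φ, (mem_sphere_zero_iff_norm).1 hΦ, fun ψ hψ => ?_⟩
  exact hmin ((mem_sphere_zero_iff_norm).2 hψ)

/-- **Sourced ground energy, upper side:** a ground state `Φ` of `K_h` has `Re⟨Φ, K_h Φ⟩ ≤ −hN/2` (compare
with `|⇒⟩`) and `Re⟨Φ, K_h Φ⟩ ≤ −BN/2` (compare with `|⇓⟩`). [cite: KomaTasaki1994, §2.4] -/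
theorem gs_energy_le {B h : ℝ} {Φ : Spins N} (hΦ : IsVariationalGS (sourced N B h) Φ) :
    (⟪Φ, sourced N B h Φ⟫_ℂ).re ≤ -(h * N / 2) ∧ (⟪Φ, sourced N B h Φ⟫_ℂ).re ≤ -(B * N / 2) := by
  constructor
  · -- trial state `|⇒⟩/‖⇒‖`
    set c : ℝ := ‖(ones : Spins N)‖⁻¹ with hc
    have hcpos : 0 < c := inv_pos.2 norm_ones_pos
    have hunit : ‖((c : ℂ) • (ones : Spins N))‖ = 1 := by
      rw [norm_smul, Complex.norm_real, Real.norm_eq_abs, abs_of_pos hcpos, hc]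
      exact inv_mul_cancel₀ norm_ones_pos.ne'
    have h1 := hΦ.2 _ hunit
    have h2 : (⟪(c : ℂ) • (ones : Spins N), sourced N B h ((c : ℂ) • ones)⟫_ℂ).re = -(h * N / 2) := by
      rw [map_smul, inner_smul_left, inner_smul_right, Complex.conj_ofReal, ← mul_assoc,
        ← Complex.ofReal_mul, Complex.re_ofReal_mul, re_inner_sourced_ones]
      have hne : ‖(ones : Spins N)‖ ≠ 0 := norm_ones_pos.ne'
      have : c * c * ‖(ones : Spins N)‖ ^ 2 = 1 := by
        rw [hc]; field_simp
      calc c * c * (-(h * N / 2) * ‖(ones : Spins N)‖ ^ 2)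
          = -(h * N / 2) * (c * c * ‖(ones : Spins N)‖ ^ 2) := by ring
        _ = -(h * N / 2) := by rw [this, mul_one]
    linarith
  · have h1 := hΦ.2 _ norm_basisVec_down
    rw [re_inner_sourced_basisVec_down] at h1
    exact h1

/-- **Response floor at fixed field.** For `B ≥ 0`, `h > 0`, every ground state `Φ` of `H − h O^{(1)}` has
`Re⟨Φ, O^{(1)} Φ⟩ ≥ (N/2)(1 − B/h)`: `h Re⟨O⟩ = Re⟨Φ, HΦ⟩ − Re⟨Φ, K_hΦ⟩ ≥ −BN/2 + hN/2`.
[cite: KomaTasaki1994, §2.4] -/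
theorem response_floor {B h : ℝ} (hB : 0 ≤ B) (hh : 0 < h) {Φ : Spins N}
    (hΦ : IsVariationalGS (sourced N B h) Φ) :
    (N : ℝ) / 2 * (1 - B / h) ≤ (⟪Φ, (paramagnet N B).order 0 Φ⟫_ℂ).re := by
  have h1 := (gs_energy_le hΦ).1
  have h2 := ground_energy_bound hB Φ
  rw [hΦ.1, one_pow, mul_one] at h2
  rw [re_inner_sourced] at h1
  -- `h * Re⟨O⟩ ≥ (h - B) N / 2`
  have h3 : (h - B) * N / 2 ≤ h * (⟪Φ, (paramagnet N B).order 0 Φ⟫_ℂ).re := by linarith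
  have h4 : (N : ℝ) / 2 * (1 - B / h) = ((h - B) * N / 2) / h := by
    field_simp
  rw [h4]
  exact (div_le_iff₀ hh).2 (by linarith)

/-- **Energy chord floor.** For `B ≥ 0`, every ground state `Φ` of `H − h O^{(1)}` lies at least `(h − B)N/2`
below EVERY unit vector's symmetric energy: `Re⟨ψ, Hψ⟩ − Re⟨Φ, K_hΦ⟩ ≥ (h − B)N/2`. [folklore] -/
private theorem chord_floor {B h : ℝ} (hB : 0 ≤ B) {Φ : Spins N} (hΦ : IsVariationalGS (sourced N B h) Φ)
    {ψ : Spins N} (hψ : ‖ψ‖ = 1) :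
    (h - B) * N / 2 ≤ (⟪ψ, (paramagnet N B).hamiltonian ψ⟫_ℂ).re - (⟪Φ, sourced N B h Φ⟫_ℂ).re := by
  have h1 := (gs_energy_le hΦ).1
  have h2 := ground_energy_bound hB ψ
  rw [hψ, one_pow, mul_one] at h2
  linarith

/-- **Response ceiling (the order parameter vanishes with the field, uniformly in `N`).** For `B > 0`, `h > 0`,
every ground state `Φ` of `H − h O^{(1)}` has `Re⟨Φ, O^{(1)} Φ⟩ ≤ 2hN/B`: compare `Re⟨Φ, K_{2h} Φ⟩ ≥
−N(B/2 + 2h²/B)` (`re_inner_sourced_ge`) with `Re⟨Φ, K_h Φ⟩ ≤ −BN/2`. [folklore] -/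
private theorem response_ceiling {B h : ℝ} (hB : 0 < B) (hh : 0 < h) {Φ : Spins N}
    (hΦ : IsVariationalGS (sourced N B h) Φ) :
    (⟪Φ, (paramagnet N B).order 0 Φ⟫_ℂ).re ≤ 2 * h * N / B := by
  have h1 := (gs_energy_le hΦ).2
  have h2 := re_inner_sourced_ge hB (h + h) Φ
  rw [hΦ.1, one_pow, mul_one, re_inner_sourced_add] at h2
  -- `h Re⟨O⟩ ≤ Re⟨Φ,K_hΦ⟩ + N (B/2 + (2h)²/(2B)) ≤ 2 N h² / B`
  have h3 : h * (⟪Φ, (paramagnet N B).order 0 Φ⟫_ℂ).re ≤ N * ((h + h) ^ 2 / (2 * B)) := by nlinarith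
  have h4 : (N : ℝ) * ((h + h) ^ 2 / (2 * B)) = h * (2 * h * N / B) := by
    field_simp; ring
  rw [h4] at h3
  exact le_of_mul_le_mul_left h3 hh

/-! ### Summary theorems -/

/-- **The gapped paramagnet's profile.** For `B > 0` and every `N`, the `U(1)` system `paramagnet N B`
(Koma–Tasaki class, constants `h = B/2`, `o = 1/2`, `r = 2` independent of `N`; on-site, translation-invariant,
volume-independent interaction) satisfies:
(1) ground energy `−BN/2` (`Re⟨ψ,Hψ⟩ ≥ −(BN/2)‖ψ‖²`), attained at `|⇓⟩`, every ground state is a multiple of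
    `|⇓⟩`, and the gap is `B` (`Re⟨ψ,Hψ⟩ ≥ (−BN/2 + B)‖ψ‖²` for `ψ ⊥ |⇓⟩`);
(2) NO long-range order: every ground state `g` has `⟨g, (O^{(1)})² g⟩ = (N/4)‖g‖²`;
(3) ground states of `H − hO^{(1)}` exist for every `h`, and for `h > 0` every one of them has RESPONSE
    `(N/2)(1 − B/h) ≤ Re⟨Φ, O^{(1)}Φ⟩ ≤ 2hN/B` and sourced energy `≤ −hN/2`.
[cite: KomaTasaki1994, §2.3–§2.5] -/
theorem paramagnet_profile (N : ℕ) {B : ℝ} (hB : 0 < B) :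
    (paramagnet N B).hbar = B / 2 ∧ (paramagnet N B).obar = 1 / 2 ∧ (paramagnet N B).r = 2 ∧
    (∀ x, (paramagnet N B).supp x = {x}) ∧
    -- (1) ground energy, ground state, uniqueness, gap
    (∀ ψ : Spins N, -(B * N / 2) * ‖ψ‖ ^ 2 ≤ (⟪ψ, (paramagnet N B).hamiltonian ψ⟫_ℂ).re) ∧
    (paramagnet N B).hamiltonian (basisVec down) = ((-(B * N / 2) : ℝ) : ℂ) • basisVec (down : Cfg N) ∧
    ‖(basisVec (down : Cfg N) : Spins N)‖ = 1 ∧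
    (∀ g : Spins N, (paramagnet N B).hamiltonian g = ((-(B * N / 2) : ℝ) : ℂ) • g →
      g = ⟪(basisVec (down : Cfg N) : Spins N), g⟫_ℂ • basisVec down) ∧
    (∀ ψ : Spins N, ⟪(basisVec (down : Cfg N) : Spins N), ψ⟫_ℂ = 0 →
      (-(B * N / 2) + B) * ‖ψ‖ ^ 2 ≤ (⟪ψ, (paramagnet N B).hamiltonian ψ⟫_ℂ).re) ∧
    -- (2) no long-range order on the ground floor
    (∀ g : Spins N, (paramagnet N B).hamiltonian g = ((-(B * N / 2) : ℝ) : ℂ) • g →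
      ⟪g, (paramagnet N B).order 0 ((paramagnet N B).order 0 g)⟫_ℂ = ((N : ℂ) / 4) * ((‖g‖ ^ 2 : ℝ) : ℂ)) ∧
    -- (3) sourced ground states: existence, response floor and ceiling, energy
    (∀ h : ℝ, ∃ Φ, IsVariationalGS (sourced N B h) Φ) ∧
    (∀ h : ℝ, 0 < h → ∀ Φ, IsVariationalGS (sourced N B h) Φ →
      (N : ℝ) / 2 * (1 - B / h) ≤ (⟪Φ, (paramagnet N B).order 0 Φ⟫_ℂ).re ∧
      (⟪Φ, (paramagnet N B).order 0 Φ⟫_ℂ).re ≤ 2 * h * N / B ∧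
      (⟪Φ, sourced N B h Φ⟫_ℂ).re ≤ -(h * N / 2)) := by
  refine ⟨by simp [paramagnet, abs_of_pos hB], rfl, rfl, fun x => rfl, ground_energy_bound hB.le,
    hamiltonian_basisVec_down B, norm_basisVec_down, fun g hg => ?_, fun ψ hψ => ?_, fun g hg => ?_,
    fun h => exists_isVariationalGS _, fun h hh Φ hΦ => ?_⟩
  · rw [inner_basisVec_down_left]
    exact eq_smul_basisVec_down_of_ground hB hg
  · rw [inner_basisVec_down_left] at hψ
    exact gap_bound hB.le hψ
  · have hg' := eq_smul_basisVec_down_of_ground hB hg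
    rw [hg', map_smul, map_smul, inner_smul_left, inner_smul_right, order_eq_spinSystem,
      inner_order_zero_sq_basisVec_down, norm_smul, mul_pow, norm_basisVec_down, ← mul_assoc,
      Complex.conj_mul']
    push_cast
    ring
  · exact ⟨response_floor hB.le hh hΦ, response_ceiling hB hh hΦ, (gs_energy_le hΦ).1⟩

end GappedParamagnet

open GappedParamagnet VanishingFieldSpins
open Literature.MathematicalPhysics.QuantumLattice.KomaTasaki

/-- **BARRIER `FiniteFieldResponseWithoutLRO` (response at a fixed symmetry-breaking field does not floor the
order).**  For every field strength `h₀ > 0` and every target `c < 1/2` there is `B ∈ (0, h₀)` (namely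
`B = h₀(1 − 2·max(c, 1/4))`) such that for EVERY volume `N ≥ 1` there is a Koma–Tasaki `U(1)` system on `N` spins `½`
with volume-INDEPENDENT constants — range `r = 2` with on-site supports, `o = 1/2` (so `c < o` is every
non-saturated response), local norm bound `h = B/2 < h₀/2` — whose symmetric Hamiltonian `H` has a UNIQUE
ground state `e` with spectral GAP `B` and NO long-range order (`⟨e, (O^{(1)})² e⟩ = N/4 = o²N`), while the
sourced Hamiltonian `H − h O^{(1)}` has ground states at every field and (response FLOOR) every ground state at
the field `h₀` has `Re⟨Φ, O^{(1)}Φ⟩ ≥ c·N` and lies at least `c·h₀·N` below the energy of every unit vector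
in the symmetric Hamiltonian (energy-chord floor),
and (response CEILING) every ground state at any field `h > 0` has `Re⟨Φ, O^{(1)}Φ⟩ ≤ (2h/B)·N` — the
field-then-volume order parameter is zero.  Hence no implication "volume-uniform response floor at ONE fixed
field ⇒ floor on LRO or on `m*`" holds over any class of `U(1)` systems containing these (translation-invariant,
finite-range, volume-independent, gapped) ones.  The witness is `GappedParamagnet.paramagnet N B`
(`H = B Σ_x S^z_x`, `O^{(1)} = Σ_x S^x_x`).

technique_class: symmetry-breaking-field pinning-field finite-field-response quasi-average Koma-Tasaki-converse response-to-LRO-transfer energy-chord Feynman-Hellmann concavity-in-coupling gapped-paramagnet volume-uniformity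
blocks: "certified response floor `N⁻¹⟨O⟩_{h₀} ≥ c` (or energy chord `(E_N(0) − E_N(h₀))/(h₀N) ≥ c`) at a FIXED field `h₀`, uniformly in `N` ⇒ floor on ground-state LRO `N⁻²⟨O²⟩` or on the quasi-average `m*`" as a transfer principle over `U(1)` systems with uniform Koma–Tasaki constants, translation invariance, volume-independent finite-range interactions, unique gapped symmetric ground states (cell `hubbard-cq` obstruction O2; LADDER row PC-a).
because: the gapped paramagnet realises every response level `c < o` at every fixed field with `m* = 0` and `⟨O²⟩ = o²N` at every volume — `FiniteFieldResponseWithoutLRO_holds`; one field bounds the nondecreasing `m(h)` only from above [cite: KomaTasaki1994, §1, §2.5] [cite: LiebSeiringerYngvason2007, §3].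
evasions_known: modulus of continuity of `m(h)` at `0⁺` / response floors along `h_i ↓ 0` (floor-type input); direct LRO proofs [cite: KennedyLiebShastry1988] used with the proved direction LRO ⇒ response [cite: KomaTasaki1994, Corollary 2.9]; model-specific structure; reporting the finite-field response as the datum it is.
scope_caveats: refutes transfer principles, not model instances; single-field hypothesis only (several fields give `m* ≤ min_i m(h_i)` and nothing below); the witness is a spin system in Koma–Tasaki's abstract class, not a lattice-fermion Hamiltonian — a class of "realistic" systems excluding it must say by which certified property.
status: established (theorem `FiniteFieldResponseWithoutLRO_holds`).
[cite: KomaTasaki1994, §1 and §2.5] [cite: LiebSeiringerYngvason2007, §3] -/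
def FiniteFieldResponseWithoutLRO : Prop :=
  ∀ h₀ : ℝ, 0 < h₀ → ∀ c : ℝ, c < 1 / 2 → ∃ B : ℝ, 0 < B ∧ B < h₀ ∧ ∀ N : ℕ, 1 ≤ N →
    ∃ sys : U1System (Fin N) (Spins N),
      -- volume-independent Koma–Tasaki constants, on-site supports
      sys.r = 2 ∧ sys.obar = 1 / 2 ∧ sys.hbar = B / 2 ∧ (∀ x, sys.supp x = {x}) ∧
      -- (a) symmetric floor: ground energy −BN/2, unique ground state `e`, gap `B`, no LRO
      (∃ e : Spins N, ‖e‖ = 1 ∧ sys.hamiltonian e = ((-(B * N / 2) : ℝ) : ℂ) • e ∧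
        (∀ ψ : Spins N, -(B * N / 2) * ‖ψ‖ ^ 2 ≤ (⟪ψ, sys.hamiltonian ψ⟫_ℂ).re) ∧
        (∀ g : Spins N, sys.hamiltonian g = ((-(B * N / 2) : ℝ) : ℂ) • g → g = ⟪e, g⟫_ℂ • e) ∧
        (∀ ψ : Spins N, ⟪e, ψ⟫_ℂ = 0 → (-(B * N / 2) + B) * ‖ψ‖ ^ 2 ≤ (⟪ψ, sys.hamiltonian ψ⟫_ℂ).re) ∧
        ⟪e, sys.order 0 (sys.order 0 e)⟫_ℂ = (N : ℂ) / 4) ∧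
      -- (b) sourced ground states exist at every field; response and chord FLOOR at the field h₀
      (∀ h : ℝ, ∃ Φ : Spins N, ‖Φ‖ = 1 ∧
        ∀ ψ : Spins N, ‖ψ‖ = 1 → (⟪Φ, (sys.hamiltonian - (h : ℂ) • sys.order 0) Φ⟫_ℂ).re ≤
          (⟪ψ, (sys.hamiltonian - (h : ℂ) • sys.order 0) ψ⟫_ℂ).re) ∧
      (∀ Φ : Spins N, ‖Φ‖ = 1 →
        (∀ ψ : Spins N, ‖ψ‖ = 1 → (⟪Φ, (sys.hamiltonian - (h₀ : ℂ) • sys.order 0) Φ⟫_ℂ).re ≤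
          (⟪ψ, (sys.hamiltonian - (h₀ : ℂ) • sys.order 0) ψ⟫_ℂ).re) →
        c * N ≤ (⟪Φ, sys.order 0 Φ⟫_ℂ).re ∧
        (∀ ψ : Spins N, ‖ψ‖ = 1 → c * h₀ * N ≤ (⟪ψ, sys.hamiltonian ψ⟫_ℂ).re -
          (⟪Φ, (sys.hamiltonian - (h₀ : ℂ) • sys.order 0) Φ⟫_ℂ).re)) ∧
      -- (c) response CEILING at every field: the field-then-volume order parameter vanishes
      (∀ h : ℝ, 0 < h → ∀ Φ : Spins N, ‖Φ‖ = 1 →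
        (∀ ψ : Spins N, ‖ψ‖ = 1 → (⟪Φ, (sys.hamiltonian - (h : ℂ) • sys.order 0) Φ⟫_ℂ).re ≤
          (⟪ψ, (sys.hamiltonian - (h : ℂ) • sys.order 0) ψ⟫_ℂ).re) →
        (⟪Φ, sys.order 0 Φ⟫_ℂ).re ≤ 2 * h / B * N)

/-- **`FiniteFieldResponseWithoutLRO` holds** — witnessed by the gapped paramagnet `paramagnet N B` with
`B = h₀(1 − 2c′)`, `c′ = max(c, 1/4)` (so that `0 < B < h₀` also for `c ≤ 0`, and `½(1 − B/h₀) = c′ ≥ c`);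
all clauses are read off `paramagnet_profile`. [cite: KomaTasaki1994, §2.3–§2.5] -/
theorem FiniteFieldResponseWithoutLRO_holds : FiniteFieldResponseWithoutLRO := by
  intro h₀ hh₀ c hc
  -- choose `B` with `(1/2)(1 − B/h₀) ≥ c`, `0 < B < h₀`: B = h₀ (1 − 2c') with c' = max c (1/4) < 1/2
  set c' : ℝ := max c (1 / 4) with hc'
  have hc'lt : c' < 1 / 2 := max_lt hc (by norm_num)
  have hc'pos : 0 < c' := lt_of_lt_of_le (by norm_num) (le_max_right _ _)
  have hcc' : c ≤ c' := le_max_left _ _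
  set B : ℝ := h₀ * (1 - 2 * c') with hBdef
  have hBpos : 0 < B := mul_pos hh₀ (by linarith)
  have hBlt : B < h₀ := by
    have : 1 - 2 * c' < 1 := by linarith
    calc B = h₀ * (1 - 2 * c') := rfl
      _ < h₀ * 1 := mul_lt_mul_of_pos_left this hh₀
      _ = h₀ := mul_one _
  have hkey : (1 : ℝ) / 2 * (1 - B / h₀) = c' := by
    rw [hBdef]; field_simp; ring
  refine ⟨B, hBpos, hBlt, fun N hN => ⟨paramagnet N B, rfl, rfl, by simp [paramagnet, abs_of_pos hBpos],
    fun x => rfl, ?_, ?_, ?_, ?_⟩⟩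
  · -- (a)
    obtain ⟨_, _, _, _, hE, hdown, hnorm, huniq, hgap, hlro, -⟩ := paramagnet_profile N hBpos
    refine ⟨basisVec down, hnorm, hdown, hE, huniq, hgap, ?_⟩
    have := hlro (basisVec down) hdown
    rw [this, hnorm]
    push_cast
    ring
  · -- (b) existence
    intro h
    obtain ⟨Φ, hΦ⟩ := exists_isVariationalGS (sourced N B h)
    exact ⟨Φ, hΦ.1, hΦ.2⟩
  · -- (b) floor at h₀
    intro Φ hΦ1 hΦ2
    have hΦ : IsVariationalGS (sourced N B h₀) Φ := ⟨hΦ1, hΦ2⟩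
    refine ⟨?_, fun ψ hψ => ?_⟩
    · have h1 := response_floor hBpos.le hh₀ hΦ
      have h2 : c * N ≤ (N : ℝ) / 2 * (1 - B / h₀) := by
        rw [show (N : ℝ) / 2 * (1 - B / h₀) = (1 / 2 * (1 - B / h₀)) * N by ring, hkey]
        exact mul_le_mul_of_nonneg_right hcc' (by positivity)
      exact h2.trans h1
    · have h1 := chord_floor hBpos.le hΦ hψ
      have h2 : c * h₀ * N ≤ (h₀ - B) * N / 2 := by
        have : (h₀ - B) / 2 = c' * h₀ := by
          have := hkey; field_simp at this ⊢; linarith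
        rw [show (h₀ - B) * N / 2 = ((h₀ - B) / 2) * N by ring, this]
        have : c * h₀ ≤ c' * h₀ := mul_le_mul_of_nonneg_right hcc' hh₀.le
        exact mul_le_mul_of_nonneg_right this (by positivity)
      exact h2.trans h1
  · -- (c) ceiling
    intro h hh Φ hΦ1 hΦ2
    have h1 := response_ceiling hBpos hh (⟨hΦ1, hΦ2⟩ : IsVariationalGS (sourced N B h) Φ)
    calc (⟪Φ, (paramagnet N B).order 0 Φ⟫_ℂ).re ≤ 2 * h * N / B := h1
      _ = 2 * h / B * N := by ring

end Literature.Barriers.HubbardSuperconductivity
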